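import Literature.Geometry.Symplectic.ZeroCircleGradientFamily
import Literature.Analysis.Calculus.ParametricLinearInverse
import Mathlib.Analysis.Calculus.FDeriv.CompCLM
import Mathlib.Analysis.Normed.Operator.BoundedLinearMaps
import Mathlib.Topology.MetricSpace.Thickening
import HarnessLib

/-!
# The block reparametrisation `q ↦ A(q₀) q` of a model tube

Topic `Geometry/Symplectic`; namespace `Literature.Geometry.Symplectic`.  One definition
(`blockReparam`) and proved lemmas; no named fact, no `sorry`.  Given a `C^∞`, `2π`-periodic
family `A(θ)` of linear automorphisms of `ℝ⁴ = ℝ e₀ ⊕ ℝ³` fixing the axis vector `e₀` (the block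
frame of `AdaptedFrameBlock`), the map `Φ(q) = A(q₀) q` is `C^∞`, fixes the axis pointwise,
commutes with the period translation `q ↦ q + 2π e₀`, has differential `A(θ)` at the axis point
`θ e₀` (`hasFDerivAt_blockReparam_hondaAxisPoint`), sends no point off the axis to the axis, and on
a thin model tube it maps into a prescribed tube with injective differential
(`exists_radius_blockReparam`, from the tube lemma `exists_hondaTube_subset_of_isOpen` for
period-invariant open neighbourhoods of the axis).  Precomposing the tubular chart of an even
zero circle with `Φ` puts the `1`-jet of the pulled-back near-symplectic form into block form in
STANDARD coordinates (Perutz 2006, proof of Lemma 3.1, step 1).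

## References

* T. Perutz, *Zero-sets of near-symplectic forms*, J. Symplectic Geom. 4 (2006), §3.
  [Perutz2006]
-/

noncomputable section

open scoped Manifold ContDiff Topology
open Set Function Filter Metric Literature.Analysis.Calculus

namespace Literature.Geometry.Symplectic

variable {A : ℝ → (EuclideanSpace ℝ (Fin 4) ≃L[ℝ] EuclideanSpace ℝ (Fin 4))}

/-! ### The axis -/

/-- `θ e₀ = single 0 θ`. [folklore] -/
theorem hondaAxisPoint_eq_single (θ : ℝ) :
    hondaAxisPoint θ = EuclideanSpace.single (0 : Fin 4) θ := by
  ext i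
  by_cases hi : i = 0
  · subst hi; simp [hondaAxisPoint]
  · simp [hondaAxisPoint, hi]

/-- A point of the axis is `θ e₀` with `θ` its axis coordinate. [folklore] -/
theorem eq_hondaAxisPoint_of_mem_hondaAxis {q : EuclideanSpace ℝ (Fin 4)} (hq : q ∈ hondaAxis) :
    q = hondaAxisPoint (q 0) := by
  rw [mem_hondaAxis] at hq
  ext i
  fin_cases i
  · simp
  · simpa [hondaAxisPoint] using hq.1
  · simpa [hondaAxisPoint] using hq.2.1
  · simpa [hondaAxisPoint] using hq.2.2

/-- Membership in a model tube only depends on the normal coordinates: it is invariant under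
axis translations. [folklore] -/
theorem add_smul_single_mem_hondaTube_iff {r : ℝ} (q : EuclideanSpace ℝ (Fin 4)) (c : ℝ) :
    q + c • EuclideanSpace.single (0 : Fin 4) (1 : ℝ) ∈ hondaTube r ↔ q ∈ hondaTube r := by
  simp [mem_hondaTube]

/-- **Tube lemma for the periodic axis**: an open set containing the axis and invariant under the
period translations `q ↦ q ± P e₀` contains a model tube. [folklore] -/
theorem exists_hondaTube_subset_of_isOpen {S : Set (EuclideanSpace ℝ (Fin 4))} (hS : IsOpen S)
    (hax : hondaAxis ⊆ S) {P : ℝ} (hP : 0 < P)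
    (hadd : ∀ q ∈ S, q + P • EuclideanSpace.single (0 : Fin 4) (1 : ℝ) ∈ S)
    (hsub : ∀ q ∈ S, q - P • EuclideanSpace.single (0 : Fin 4) (1 : ℝ) ∈ S) :
    ∃ r : ℝ, 0 < r ∧ hondaTube r ⊆ S := by
  -- a uniform thickening of one compact period of the axis
  set K : Set (EuclideanSpace ℝ (Fin 4)) := hondaAxisPoint '' Icc 0 P with hK
  have hKc : IsCompact K := isCompact_Icc.image contDiff_hondaAxisPoint.continuous
  have hKS : K ⊆ S := by
    rintro _ ⟨θ, -, rfl⟩; exact hax (hondaAxisPoint_mem_hondaAxis θ)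
  obtain ⟨δ, hδ, hthick⟩ := hKc.exists_thickening_subset_open hS hKS
  refine ⟨δ, hδ, fun q hq ↦ ?_⟩
  -- integer translates stay in `S`
  have hZ : ∀ q' ∈ S, ∀ k : ℤ, q' + ((k : ℝ) * P) • EuclideanSpace.single (0 : Fin 4) (1 : ℝ) ∈ S := by
    intro q' hq' k
    induction k using Int.induction_on with
    | zero => simpa using hq'
    | succ n ih =>
      have := hadd _ ih
      rw [add_assoc, ← add_smul] at this
      convert this using 3; push_cast; ring
    | pred n ih =>
      have := hsub _ ih
      rw [sub_eq_add_neg, add_assoc, ← neg_smul, ← add_smul] at this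
      convert this using 3; push_cast; ring
  -- reduce the axis coordinate into `[0, P)`
  set k : ℤ := toIcoDiv hP 0 (q 0) with hk
  set q' : EuclideanSpace ℝ (Fin 4) := q + ((-k : ℤ) * P : ℝ) • EuclideanSpace.single (0 : Fin 4) 1
    with hq'
  have hq'0 : q' 0 ∈ Ico 0 P := by
    have h := sub_toIcoDiv_zsmul_mem_Ico hP 0 (q 0)
    rw [zero_add, ← hk, zsmul_eq_mul] at h
    have : q' 0 = q 0 - k * P := by simp [hq']; ring
    rw [this]; exact h
  have hq'T : q' ∈ hondaTube δ := (add_smul_single_mem_hondaTube_iff q _).2 hq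
  have hq'S : q' ∈ S := by
    refine hthick (mem_thickening_iff.2 ⟨hondaAxisPoint (q' 0), ⟨q' 0, ⟨hq'0.1, hq'0.2.le⟩, rfl⟩, ?_⟩)
    rw [dist_eq_norm, hondaAxisPoint_eq_single]
    exact norm_sub_single_lt_of_mem_hondaTube hδ hq'T
  have := hZ q' hq'S k
  rw [hq', add_assoc, ← add_smul] at this
  convert this using 2
  push_cast
  simp

/-! ### The reparametrisation -/

/-- **The block reparametrisation** `Φ(q) = A(q₀) q`. [cite: Perutz2006, §3 (proof of Lemma 3.1, step 1)] -/
def blockReparam (A : ℝ → (EuclideanSpace ℝ (Fin 4) ≃L[ℝ] EuclideanSpace ℝ (Fin 4)))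
    (q : EuclideanSpace ℝ (Fin 4)) : EuclideanSpace ℝ (Fin 4) :=
  A (q 0) q

/-- Unfolding `blockReparam`. [folklore] -/
theorem blockReparam_apply (q : EuclideanSpace ℝ (Fin 4)) : blockReparam A q = A (q 0) q := rfl

/-- The operator family `q ↦ A(q₀)` is `C^∞`. [folklore] -/
theorem contDiff_blockReparamCLM (hAs : ∀ u, ContDiff ℝ ∞ fun θ ↦ A θ u) :
    ContDiff ℝ ∞ fun q : EuclideanSpace ℝ (Fin 4) ↦
      ((A (q 0) : EuclideanSpace ℝ (Fin 4) ≃L[ℝ] EuclideanSpace ℝ (Fin 4)) :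
        EuclideanSpace ℝ (Fin 4) →L[ℝ] EuclideanSpace ℝ (Fin 4)) := by
  have h1 : ContDiff ℝ ∞ fun θ : ℝ ↦ ((A θ : EuclideanSpace ℝ (Fin 4) ≃L[ℝ] EuclideanSpace ℝ (Fin 4)) :
      EuclideanSpace ℝ (Fin 4) →L[ℝ] EuclideanSpace ℝ (Fin 4)) :=
    contDiff_clm_of_apply_single fun i ↦ hAs _
  exact h1.comp
    (EuclideanSpace.proj (0 : Fin 4) : EuclideanSpace ℝ (Fin 4) →L[ℝ] ℝ).contDiff

/-- **`Φ` is `C^∞`.** [folklore] -/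
theorem contDiff_blockReparam (hAs : ∀ u, ContDiff ℝ ∞ fun θ ↦ A θ u) :
    ContDiff ℝ ∞ (blockReparam A) :=
  (contDiff_blockReparamCLM hAs).clm_apply contDiff_id

/-- `A(θ)` fixes `single 0 1 = e₀`. [folklore] -/
theorem apply_single_zero_one (hA0 : ∀ θ, A θ (stdVec 0) = stdVec 0) (θ : ℝ) :
    A θ (EuclideanSpace.single (0 : Fin 4) (1 : ℝ)) = EuclideanSpace.single 0 1 :=
  hA0 θ

/-- **`Φ` fixes the axis pointwise.** [folklore] -/
theorem blockReparam_hondaAxisPoint (hA0 : ∀ θ, A θ (stdVec 0) = stdVec 0) (θ : ℝ) :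
    blockReparam A (hondaAxisPoint θ) = hondaAxisPoint θ := by
  rw [blockReparam_apply, hondaAxisPoint_apply_zero]
  unfold hondaAxisPoint
  rw [map_smul, apply_single_zero_one hA0]

/-- **`Φ` commutes with the period translation.** [folklore] -/
theorem blockReparam_add_smul (hA0 : ∀ θ, A θ (stdVec 0) = stdVec 0) {P : ℝ}
    (hAP : ∀ θ, A (θ + P) = A θ) (q : EuclideanSpace ℝ (Fin 4)) :
    blockReparam A (q + P • EuclideanSpace.single (0 : Fin 4) (1 : ℝ)) =
      blockReparam A q + P • EuclideanSpace.single (0 : Fin 4) (1 : ℝ) := by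
  rw [blockReparam_apply, blockReparam_apply]
  have h0 : (q + P • EuclideanSpace.single (0 : Fin 4) (1 : ℝ)) 0 = q 0 + P := by simp
  rw [h0, hAP, map_add, map_smul, apply_single_zero_one hA0]

/-- `Φ` commutes with the inverse period translation. [folklore] -/
theorem blockReparam_sub_smul (hA0 : ∀ θ, A θ (stdVec 0) = stdVec 0) {P : ℝ}
    (hAP : ∀ θ, A (θ + P) = A θ) (q : EuclideanSpace ℝ (Fin 4)) :
    blockReparam A (q - P • EuclideanSpace.single (0 : Fin 4) (1 : ℝ)) =
      blockReparam A q - P • EuclideanSpace.single (0 : Fin 4) (1 : ℝ) := by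
  have := blockReparam_add_smul hA0 hAP (q - P • EuclideanSpace.single (0 : Fin 4) (1 : ℝ))
  rw [sub_add_cancel] at this
  rw [this, add_sub_cancel_right]

/-- **Only axis points are sent to the axis.** [folklore] -/
theorem mem_hondaAxis_of_blockReparam_mem (hA0 : ∀ θ, A θ (stdVec 0) = stdVec 0)
    {q : EuclideanSpace ℝ (Fin 4)} (hq : blockReparam A q ∈ hondaAxis) : q ∈ hondaAxis := by
  have h1 := eq_hondaAxisPoint_of_mem_hondaAxis hq
  rw [blockReparam_apply] at h1
  set c := (A (q 0) q) 0 with hc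
  have h2 : A (q 0) q = A (q 0) (hondaAxisPoint c) := by
    rw [h1]; unfold hondaAxisPoint; rw [map_smul, apply_single_zero_one hA0]
  have h3 : q = hondaAxisPoint c := (A (q 0)).injective h2
  rw [h3]; exact hondaAxisPoint_mem_hondaAxis c

/-! ### The differential at the axis -/

/-- **`dΦ_{θ e₀} = A(θ)`**: the derivative of `q ↦ A(q₀)` contributes nothing at the axis,
because `A(·)` fixes `θ e₀`. [cite: Perutz2006, §3 (proof of Lemma 3.1, step 1)] -/
theorem hasFDerivAt_blockReparam_hondaAxisPoint (hAs : ∀ u, ContDiff ℝ ∞ fun θ ↦ A θ u)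
    (hA0 : ∀ θ, A θ (stdVec 0) = stdVec 0) (θ : ℝ) :
    HasFDerivAt (blockReparam A)
      ((A θ : EuclideanSpace ℝ (Fin 4) ≃L[ℝ] EuclideanSpace ℝ (Fin 4)) :
        EuclideanSpace ℝ (Fin 4) →L[ℝ] EuclideanSpace ℝ (Fin 4)) (hondaAxisPoint θ) := by
  set a := hondaAxisPoint θ with ha
  set c : EuclideanSpace ℝ (Fin 4) → (EuclideanSpace ℝ (Fin 4) →L[ℝ] EuclideanSpace ℝ (Fin 4)) :=
    fun q ↦ ((A (q 0) : EuclideanSpace ℝ (Fin 4) ≃L[ℝ] EuclideanSpace ℝ (Fin 4)) :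
      EuclideanSpace ℝ (Fin 4) →L[ℝ] EuclideanSpace ℝ (Fin 4)) with hc_def
  have hcd : HasFDerivAt c (fderiv ℝ c a) a :=
    (((contDiff_blockReparamCLM hAs).differentiable (by simp)) a).hasFDerivAt
  -- the evaluation `q ↦ c q a` is constant, so `(fderiv c a) W a = 0`
  have hconst : ∀ q, c q a = a := fun q ↦ by
    simp only [hc_def, ha]
    unfold hondaAxisPoint
    rw [ContinuousLinearEquiv.coe_coe, map_smul, apply_single_zero_one hA0]
  have hflip : (fderiv ℝ c a).flip a = 0 := by
    have h1 : HasFDerivAt (fun q ↦ c q a) ((c a).comp (0 : EuclideanSpace ℝ (Fin 4) →L[ℝ]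
        EuclideanSpace ℝ (Fin 4)) + (fderiv ℝ c a).flip a) a :=
      hcd.clm_apply (hasFDerivAt_const a a)
    have h2 : HasFDerivAt (fun q ↦ c q a) (0 : EuclideanSpace ℝ (Fin 4) →L[ℝ]
        EuclideanSpace ℝ (Fin 4)) a := by
      have : (fun q ↦ c q a) = fun _ ↦ a := funext hconst
      rw [this]; exact hasFDerivAt_const a a
    have := h1.unique h2
    rwa [ContinuousLinearMap.comp_zero, zero_add] at this
  have h := hcd.clm_apply (hasFDerivAt_id a)
  change HasFDerivAt (fun y ↦ c y y) ((c a).comp (ContinuousLinearMap.id ℝ _) +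
    (fderiv ℝ c a).flip a) a at h
  rw [hflip, add_zero, ContinuousLinearMap.comp_id] at h
  have hca : c a = ((A θ : EuclideanSpace ℝ (Fin 4) ≃L[ℝ] EuclideanSpace ℝ (Fin 4)) :
      EuclideanSpace ℝ (Fin 4) →L[ℝ] EuclideanSpace ℝ (Fin 4)) := by
    simp only [hc_def, ha, hondaAxisPoint_apply_zero]
  rw [hca] at h
  exact h

/-- `fderiv Φ (θ e₀) = A(θ)`. [folklore] -/
theorem fderiv_blockReparam_hondaAxisPoint (hAs : ∀ u, ContDiff ℝ ∞ fun θ ↦ A θ u)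
    (hA0 : ∀ θ, A θ (stdVec 0) = stdVec 0) (θ : ℝ) :
    fderiv ℝ (blockReparam A) (hondaAxisPoint θ) =
      ((A θ : EuclideanSpace ℝ (Fin 4) ≃L[ℝ] EuclideanSpace ℝ (Fin 4)) :
        EuclideanSpace ℝ (Fin 4) →L[ℝ] EuclideanSpace ℝ (Fin 4)) :=
  (hasFDerivAt_blockReparam_hondaAxisPoint hAs hA0 θ).fderiv

/-- The differential of `Φ` is invariant under the period translation. [folklore] -/
theorem fderiv_blockReparam_add_smul
    (hA0 : ∀ θ, A θ (stdVec 0) = stdVec 0) {P : ℝ} (hAP : ∀ θ, A (θ + P) = A θ)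
    (q : EuclideanSpace ℝ (Fin 4)) :
    fderiv ℝ (blockReparam A) (q + P • EuclideanSpace.single (0 : Fin 4) (1 : ℝ)) =
      fderiv ℝ (blockReparam A) q := by
  rw [← fderiv_comp_add_right]
  have h : (fun x ↦ blockReparam A (x + P • EuclideanSpace.single (0 : Fin 4) (1 : ℝ))) =
      fun x ↦ blockReparam A x + P • EuclideanSpace.single (0 : Fin 4) (1 : ℝ) :=
    funext fun x ↦ blockReparam_add_smul hA0 hAP x
  rw [h, fderiv_add_const]

/-! ### A thin tube on which `Φ` is controlled -/

/-- **On a thin tube, `Φ` maps into a prescribed tube and has injective differential.**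
[cite: Perutz2006, §3 (proof of Lemma 3.1, step 1)] -/
theorem exists_radius_blockReparam (hAs : ∀ u, ContDiff ℝ ∞ fun θ ↦ A θ u)
    (hA0 : ∀ θ, A θ (stdVec 0) = stdVec 0) {P : ℝ} (hP : 0 < P) (hAP : ∀ θ, A (θ + P) = A θ)
    {r : ℝ} (hr : 0 < r) :
    ∃ r₂ : ℝ, 0 < r₂ ∧ MapsTo (blockReparam A) (hondaTube r₂) (hondaTube r) ∧
      ∀ q ∈ hondaTube r₂, Injective (fderiv ℝ (blockReparam A) q) := by
  have hΦc : Continuous (blockReparam A) := (contDiff_blockReparam hAs).continuous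
  -- (1) into the tube
  set S₁ : Set (EuclideanSpace ℝ (Fin 4)) := blockReparam A ⁻¹' hondaTube r with hS₁
  have hS₁o : IsOpen S₁ := (isOpen_hondaTube r).preimage hΦc
  have hS₁ax : hondaAxis ⊆ S₁ := fun q hq ↦ by
    rw [hS₁, mem_preimage, eq_hondaAxisPoint_of_mem_hondaAxis hq, blockReparam_hondaAxisPoint hA0]
    exact hondaAxis_subset_hondaTube hr (hondaAxisPoint_mem_hondaAxis _)
  obtain ⟨r₁, hr₁, hT₁⟩ := exists_hondaTube_subset_of_isOpen hS₁o hS₁ax hP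
    (fun q hq ↦ by
      rw [hS₁, mem_preimage, blockReparam_add_smul hA0 hAP]
      exact (add_smul_single_mem_hondaTube_iff _ _).2 hq)
    (fun q hq ↦ by
      rw [hS₁, mem_preimage, blockReparam_sub_smul hA0 hAP, sub_eq_add_neg, ← neg_smul]
      exact (add_smul_single_mem_hondaTube_iff _ _).2 hq)
  -- (2) injective differential
  set S₂ : Set (EuclideanSpace ℝ (Fin 4)) := fderiv ℝ (blockReparam A) ⁻¹'
    range ((↑) : (EuclideanSpace ℝ (Fin 4) ≃L[ℝ] EuclideanSpace ℝ (Fin 4)) →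
      EuclideanSpace ℝ (Fin 4) →L[ℝ] EuclideanSpace ℝ (Fin 4)) with hS₂
  have hS₂o : IsOpen S₂ := ContinuousLinearEquiv.isOpen.preimage
    ((contDiff_blockReparam hAs).continuous_fderiv (by simp))
  have hS₂ax : hondaAxis ⊆ S₂ := fun q hq ↦ by
    rw [hS₂, mem_preimage, eq_hondaAxisPoint_of_mem_hondaAxis hq,
      fderiv_blockReparam_hondaAxisPoint hAs hA0]
    exact ⟨A (q 0), rfl⟩
  obtain ⟨r₂, hr₂, hT₂⟩ := exists_hondaTube_subset_of_isOpen hS₂o hS₂ax hP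
    (fun q hq ↦ by rwa [hS₂, mem_preimage, fderiv_blockReparam_add_smul hA0 hAP])
    (fun q hq ↦ by
      have := fderiv_blockReparam_add_smul hA0 hAP
        (q - P • EuclideanSpace.single (0 : Fin 4) (1 : ℝ))
      rw [sub_add_cancel] at this
      rw [hS₂, mem_preimage, ← this]; exact hq)
  refine ⟨min r₁ r₂, lt_min hr₁ hr₂, fun q hq ↦ hT₁ (hondaTube_mono (lt_min hr₁ hr₂).le
    (min_le_left _ _) hq), fun q hq ↦ ?_⟩
  obtain ⟨e, he⟩ := hT₂ (hondaTube_mono (lt_min hr₁ hr₂).le (min_le_right _ _) hq)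
  rw [← he]
  exact e.injective

/-- **`Φ` is injective near every axis point** (inverse function theorem). [folklore] -/
theorem exists_nhds_injOn_blockReparam (hAs : ∀ u, ContDiff ℝ ∞ fun θ ↦ A θ u)
    (hA0 : ∀ θ, A θ (stdVec 0) = stdVec 0) (θ : ℝ) :
    ∃ U ∈ 𝓝 (hondaAxisPoint θ), InjOn (blockReparam A) U := by
  have hcd : ContDiffAt ℝ ∞ (blockReparam A) (hondaAxisPoint θ) :=
    (contDiff_blockReparam hAs).contDiffAt
  set e := hcd.toOpenPartialHomeomorph (blockReparam A)
    (hasFDerivAt_blockReparam_hondaAxisPoint hAs hA0 θ) (by simp) with he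
  refine ⟨e.source, e.open_source.mem_nhds (hcd.mem_toOpenPartialHomeomorph_source _ (by simp)),
    ?_⟩
  have : (e : EuclideanSpace ℝ (Fin 4) → EuclideanSpace ℝ (Fin 4)) = blockReparam A :=
    hcd.toOpenPartialHomeomorph_coe _ (by simp)
  rw [← this]
  exact e.injOn

end Literature.Geometry.Symplectic

end
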